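import Literature.Claims.NS.Feinstein2025
import HarnessLib

/-!
# C91 `Feinstein2025` — refutation certificate against `Literature.Claims.NS.Feinstein2025` (cell
`ns-claims`, D-0090; refuter of record ns-claims-refuter-1; skeleton typist-6 g2 p486851)

Text of record: I. Feinstein, Zenodo 17281263 v2 (main `NSE_CLAY.pdf` 4 pp. + appendix 4 pp.;
PDF page = printed page). The skeleton types the printed two-line proof of Theorem 7.1 (main p.3
l.90–92) at the abstract grain: `Step3_GronwallOnGoodSlabs_abs` (line 1 «From Theorem 6.2 …
Grönwall yields F(t) < ∞», with Theorem 6.2 printed «On good slabs» only — Standing Assumption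
2.1, main p.2) →
`Step4_BernsteinBKM_abs` (TRUE, `step4_holds`) → `Step5_Bridge` → `claim_of_steps`.

* `not_Step3_GronwallOnGoodSlabs_abs` — **Step 3 is false as used**, with a witness in which HALF of
  the time interval is good: `T = 1`, good set `G = (0, ½)`, `F(t) = (1 − t)⁻¹`, `F′(t) = F(t)²`,
  `c = 0`, `D ≡ 0`, `C = 1`, `Φ ≡ 2` (integrable on `(0,1)`). On `G` the CLI inequality
  `F′ + cD ≤ CΦF` holds (`(1 − t)⁻² ≤ 2(1 − t)⁻¹` iff `t ≤ ½`), every sign / integrability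
  hypothesis holds, and `F` is unbounded on `(0,1)`. (The typist kit's face is the degenerate
  `G = ∅`; this one shows that no proportion of good slabs short of a neighbourhood of `T` rescues
  the inference.)
* `step5_Bridge_of_not_step3` — RECORD: the bridge then holds vacuously (skeleton
  `step5_of_not_step3`), so Step 3 is the first failing step in dependency order.

Nothing here decides Clay (A): `ClaimedTheorem` is (A)-shaped and is neither proved nor refuted.
WHAT THIS IS NOT: not a claim about NS regularity or blow-up; not a claim about any author beyond
the typed locator.
-/

set_option linter.dupNamespace false

open Set MeasureTheory

namespace Summit.NavierStokesRegularity.NavierStokesRegularity.Theorems.Feinstein2025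

noncomputable section

/-- The blow-up profile `F(t) = (1 − t)⁻¹` of the witness. [folklore] -/
def fsBlowup (t : ℝ) : ℝ := (1 - t)⁻¹

/-- Its derivative `F′(t) = (1 − t)⁻¹ · (1 − t)⁻¹` (valid for `t ≠ 1`). [folklore] -/
def fsBlowupDeriv (t : ℝ) : ℝ := (1 - t)⁻¹ * (1 - t)⁻¹

/-- `F′ = F²` away from `t = 1`. [folklore] -/
theorem hasDerivAt_fsBlowup {t : ℝ} (ht : t ≠ 1) :
    HasDerivAt fsBlowup (fsBlowupDeriv t) t := by
  have hne : (1 : ℝ) - t ≠ 0 := sub_ne_zero.2 (Ne.symm ht)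
  have h1 : HasDerivAt (fun y : ℝ => 1 - y) (-1) t := by
    simpa using (hasDerivAt_id t).const_sub (1 : ℝ)
  have h2 := h1.inv hne
  have hval : -(-1 : ℝ) / (1 - t) ^ 2 = fsBlowupDeriv t := by
    rw [neg_neg, fsBlowupDeriv, sq, one_div, mul_inv]
  rw [← hval]
  exact h2

/-- On the good set `(0, ½)` the CLI inequality `F′ + 0·D ≤ 1·2·F` holds. [folklore] -/
theorem cli_on_goodHalf {t : ℝ} (ht : t ∈ Ioo (0 : ℝ) (1 / 2)) :
    fsBlowupDeriv t + 0 * (0 : ℝ) ≤ 1 * 2 * fsBlowup t := by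
  have hpos : 0 < 1 - t := by linarith [ht.2]
  have hinv : (1 - t)⁻¹ ≤ 2 := by
    rw [inv_le_comm₀ hpos (by norm_num : (0 : ℝ) < 2)]
    linarith [ht.2]
  have hinv0 : 0 ≤ (1 - t)⁻¹ := inv_nonneg.2 hpos.le
  rw [fsBlowupDeriv, fsBlowup, zero_mul, add_zero, one_mul, mul_comm (2 : ℝ)]
  exact mul_le_mul_of_nonneg_left hinv hinv0

/-- `F` is unbounded on `(0,1)`: `F(1 − 1/a) = a` for `a = |M| + 2`. [folklore] -/
theorem fsBlowup_unbounded (M : ℝ) : ∃ t ∈ Ioo (0 : ℝ) 1, M < fsBlowup t := by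
  set a : ℝ := |M| + 2 with ha
  have ha2 : 2 ≤ a := by have := abs_nonneg M; linarith
  have hapos : 0 < a := by linarith
  refine ⟨1 - a⁻¹, ⟨?_, ?_⟩, ?_⟩
  · have : a⁻¹ ≤ 2⁻¹ := by
      rw [inv_le_inv₀ hapos (by norm_num : (0 : ℝ) < 2)]; exact ha2
    linarith [this, (by norm_num : (2 : ℝ)⁻¹ < 1)]
  · have : 0 < a⁻¹ := inv_pos.2 hapos
    linarith
  · have hF : fsBlowup (1 - a⁻¹) = a := by
      rw [fsBlowup, sub_sub_cancel, inv_inv]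
    rw [hF, ha]
    have := le_abs_self M
    linarith

/-- **Step 3 fails as used** (proof of Theorem 7.1 line 1, main p.3 l.90–91 «From Theorem 6.2 …
Grönwall yields F(t) < ∞», = app. §7 p.4 l.2–3; Theorem 6.2 is printed «On good slabs», Standing
Assumption 2.1 main p.2): a differential inequality available only on a good set `G ⊊ (0,T)` does
not bound `F` on `(0,T)` — witness `T = 1`, `G = (0, ½)`, `F = (1 − t)⁻¹`, `c = 0`, `D ≡ 0`,
`C = 1`, `Φ ≡ 2`.
[cite: Feinstein2025, Thm 7.1 proof main p.3; Thm 6.2 main p.3; Assumption 2.1 main p.2] -/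
theorem not_Step3_GronwallOnGoodSlabs_abs :
    ¬ Literature.Claims.NS.Feinstein2025.Step3_GronwallOnGoodSlabs_abs := by
  intro h
  have hG : Ioo (0 : ℝ) (1 / 2) ⊆ Ioo (0 : ℝ) 1 := Ioo_subset_Ioo le_rfl (by norm_num)
  have hint : IntegrableOn (fun _ : ℝ => (2 : ℝ)) (Ioo (0 : ℝ) 1) := by
    have hfin : volume (Ioo (0 : ℝ) 1) ≠ ⊤ := by simp
    exact integrableOn_const hfin
  obtain ⟨M, hM⟩ := h 1 0 1 fsBlowup (fun _ => 0) (fun _ => 2) fsBlowupDeriv (Ioo 0 (1 / 2))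
    one_pos le_rfl zero_le_one
    (fun t ht => inv_nonneg.2 (by linarith [ht.2])) (fun _ _ => le_rfl)
    (fun _ _ => by norm_num) hint hG
    (fun t ht => ⟨hasDerivAt_fsBlowup (by linarith [ht.2] : t ≠ 1), cli_on_goodHalf ht⟩)
  obtain ⟨t, ht, hlt⟩ := fsBlowup_unbounded M
  exact absurd (hM t ht) (not_le.2 hlt)

/-- RECORD: with Step 3 false, the printed bridge `Step5_Bridge` holds vacuously — Step 3 is the
first failing step in dependency order. [cite: Feinstein2025, Thm 7.1 proof main p.3] -/
theorem step5_Bridge_of_not_step3 : Literature.Claims.NS.Feinstein2025.Step5_Bridge :=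
  Literature.Claims.NS.Feinstein2025.step5_of_not_step3 not_Step3_GronwallOnGoodSlabs_abs

end

end Summit.NavierStokesRegularity.NavierStokesRegularity.Theorems.Feinstein2025
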